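import Summits.KontsevichZagierPeriods.Zeta5Search.Zudilin2002IntegralityCentreFree
import HarnessLib

/-!
# Zudilin 2002's integrality: the residual is a DERIVATIVE — reflection symmetry of the centre-free cells and the
first `K`-moment form (cell `pub-zeta5`, seat ct-1 g41, second sequel)

HONEST FRAMING: systematic search; no irrationality claim unless certified.  Bookkeeping of the partial-fraction cells
`c̃_{K,s}(n) = cell 6 1 0 n K s` of the centre-free (plain Ball–Rivoal) kernel `R̃_n(t) = n!⁴(t−n)_n(t+n+1)_n/(t)_{n+1}⁶ =
BallRivoal.R 6 1 n`; nothing here concerns the arithmetic nature of `ζ(5)`/`ζ(3)`; records in print UNMOVED; NOTHING IS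
DISCHARGED (`Zudilin2002.integrality` stays a named fact, net debt 0).

OUR work (Summit side), sequel of `Zudilin2002IntegralityCentreFree` (same seat), which reduced the named fact to the
`2`-integrality of the first `(n − 2K)`-moments `W_s(n) = Σ_K (n−2K)c̃_{K,s}(n)` (`s = 5, 3`) and `W_0(n)` of the centre-free
kernel.  Here:

* `cell_zero_reflect` — **`c̃_{n−K,s}(n) = (−1)^s·c̃_{K,s}(n)`** (all orders `s`, all poles): Rivoal's well-poised reflection
  `R̃_n(−t−n−2) = R̃_n(t)` (`BallRivoal.R_reflect`, `pf_R_symm`, `a = 6` even) transferred to the tree's cells by uniqueness of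
  partial fractions (`cell_zero_eq_data`);
* `xCoeff_zero_eq_zero_of_odd` — hence **`x̃_s(n) = Σ_K c̃_{K,s}(n) = 0` for odd `s`**: the plain kernel `(6,1,0)` carries NO
  odd zeta value (the reason the very-well-poised centre factor is there at all), and
* `moment_eq_neg_two_mul` — `W_s(n) = −2·Σ_K K·c̃_{K,s}(n)` for odd `s`: the antisymmetric moment is (minus twice) the plain
  FIRST `K`-MOMENT, i.e. the derivative at `X = 1` of the coefficient polynomial `p̃_{s,n}(X) = Σ_K c̃_{K,s}X^K`;
* **`integrality_of_derivative`** — **`Zudilin2002.integrality` ⇐ `2·Σ_K K c̃_{K,5}(n) ∈ ℤ₍₂₎ ∧ 2D_n²·Σ_K K c̃_{K,3}(n) ∈ ℤ₍₂₎ ∧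
  D_n⁵·W_0(n) ∈ ℤ₍₂₎` for all `n`**.  In Krattenthaler–Rivoal's language: their Théorème 1 bounds the VALUES `p_{l,n}(1)`;
  what is left of Zudilin's named fact at the prime `2` is the same saving for the DERIVATIVES `p̃′_{5,n}(1)`, `p̃′_{3,n}(1)` of
  the PLAIN kernel's coefficient polynomials (up to one factor `2`) and for the harmonic moment `W_0`.

DATA (seat desk `alg/moments_p2.py`, exact, `n ≤ 170`; not used by the kernel): `W_6 = W_4 = W_2 = 0`; `ord₂(W_5(n)) = 1`,
`ord₂(2^{2ℓ}W_3(n)) = 1`, `ord₂(2^{5ℓ}W_0(n)) = 1` EXACTLY (`ℓ = ⌊log₂ n⌋`) and `ord₂(2^{4ℓ}W_1(n)) ≥ 2` (`= 2` at `n = 2^a`) for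
EVERY `n ≤ 170` — the hypothesis below holds there with one factor `2` to spare, uniformly.
-/

noncomputable section

open WithZero Finset

namespace Summit.KontsevichZagierPeriods.Zeta5Search.Zudilin2002IntegralityDerivative

open Literature.NumberTheory.Irrationality.Zudilin2002 (integrality)
open Literature.NumberTheory.Transcendental (BallRivoal.R BallRivoal.pfEval BallRivoal.exists_pf_R BallRivoal.pf_unique
  BallRivoal.pfEval_sub' BallRivoal.pf_R_symm)
open Summit.KontsevichZagierPeriods.Zeta5Search.BrickLaurent (cell)
open Summit.KontsevichZagierPeriods.Zeta5Search.BrickPartialFractions (xCoeff cellZero)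
open Summit.KontsevichZagierPeriods.Zeta5Search.BrickLinearForms (pfEval_cell)
open Summit.KontsevichZagierPeriods.Zeta5Search.Zudilin2002IntegralityCentreFree (brickKernel_zero_eq_R
  integrality_of_moments)

/-! ### Cells = partial-fraction data of `R_{6,1}`; reflection -/

/-- **Any partial-fraction data of `BallRivoal.R 6 1 n` are the tree's centre-free cells**: if
`pfEval n 6 c t = R_{6,1,n}(t)` off the poles, then `c o K = c̃_{K,o+1}(n)` (`o < 6`, `K ≤ n`). -/
theorem cell_zero_eq_data (n : ℕ) {c : ℕ → ℕ → ℚ}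
    (hc : ∀ t : ℚ, (∀ m, m ≤ n → t + m + 1 ≠ 0) → BallRivoal.pfEval n 6 c t = BallRivoal.R 6 1 n t)
    {o K : ℕ} (ho : o < 6) (hK : K ≤ n) : c o K = cell 6 1 0 n K (o + 1) := by
  have h0 := BallRivoal.pf_unique n 6 (fun o p => c o p - cell 6 1 0 n p (o + 1)) 0 (fun t _ => ?_) o K ho hK
  · exact sub_eq_zero.1 h0
  · have hne : ∀ m : ℕ, m ≤ n → (t : ℚ) + m + 1 ≠ 0 := fun m _ => by positivity
    rw [BallRivoal.pfEval_sub', hc t hne, pfEval_cell (A := 6) (B := 1) (by norm_num) (by norm_num) n hne,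
      brickKernel_zero_eq_R, sub_self]

/-- **Reflection of the centre-free cells**: `c̃_{n−K,s}(n) = (−1)^s·c̃_{K,s}(n)` (`1 ≤ s ≤ 6`, `K ≤ n`) — Rivoal's well-poised
symmetry `R̃_n(−t−n−2) = (−1)^{6(n+1)}R̃_n(t) = R̃_n(t)` (`BallRivoal.pf_R_symm` at `a = 6`). -/
theorem cell_zero_reflect (n : ℕ) {s K : ℕ} (hs1 : 1 ≤ s) (hs : s ≤ 6) (hK : K ≤ n) :
    cell 6 1 0 n (n - K) s = (-1) ^ s * cell 6 1 0 n K s := by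
  obtain ⟨c, hc, -, -⟩ := BallRivoal.exists_pf_R 6 1 n (Nat.lcmUpto n) (by norm_num) (by norm_num)
    (fun k h1 h2 => by
      rw [Int.natCast_dvd_natCast, Nat.lcmUpto]
      exact Finset.dvd_lcm (Finset.mem_Icc.2 ⟨h1, h2⟩))
  obtain ⟨o, rfl⟩ : ∃ o, s = o + 1 := ⟨s - 1, by omega⟩
  have hsym := BallRivoal.pf_R_symm 6 1 n c hc o K (by omega) hK
  rw [cell_zero_eq_data n hc (by omega) hK, cell_zero_eq_data n hc (by omega) (Nat.sub_le n K)] at hsym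
  have h1 : ((-1 : ℚ)) ^ (6 * (n + 1)) = 1 := by
    rw [show 6 * (n + 1) = 2 * (3 * (n + 1)) by ring, pow_mul]; norm_num
  rw [hsym, h1, mul_one]

/-- **The plain kernel carries no odd zeta value**: `x̃_s(n) = Σ_K c̃_{K,s}(n) = 0` for odd `s ≤ 6`. -/
theorem xCoeff_zero_eq_zero_of_odd (n : ℕ) {s : ℕ} (hodd : Odd s) (hs : s ≤ 6) : xCoeff 6 1 0 n s = 0 := by
  have hs1 : 1 ≤ s := hodd.pos
  have hrefl : xCoeff 6 1 0 n s = ∑ K ∈ range (n + 1), cell 6 1 0 n (n - K) s := by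
    rw [xCoeff]
    conv_lhs => rw [← sum_range_reflect]
    exact sum_congr rfl fun K _ => congrArg (fun j => cell 6 1 0 n j s) (by omega)
  have hneg : ∑ K ∈ range (n + 1), cell 6 1 0 n (n - K) s = -xCoeff 6 1 0 n s := by
    rw [xCoeff, ← neg_one_mul, mul_sum]
    refine sum_congr rfl fun K hK => ?_
    rw [cell_zero_reflect n hs1 hs (by have := mem_range.1 hK; omega), hodd.neg_one_pow]
  linarith

/-- **The antisymmetric moment is minus twice the first `K`-moment**: `Σ_K (n−2K)c̃_{K,s}(n) = −2·Σ_K K·c̃_{K,s}(n)` for odd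
`s ≤ 6` (since `n·x̃_s(n) = 0`). -/
theorem moment_eq_neg_two_mul (n : ℕ) {s : ℕ} (hodd : Odd s) (hs : s ≤ 6) :
    ∑ K ∈ range (n + 1), ((n : ℚ) - 2 * K) * cell 6 1 0 n K s =
      -2 * ∑ K ∈ range (n + 1), (K : ℚ) * cell 6 1 0 n K s := by
  have h0 := xCoeff_zero_eq_zero_of_odd n hodd hs
  rw [xCoeff] at h0
  have : ∑ K ∈ range (n + 1), ((n : ℚ) - 2 * K) * cell 6 1 0 n K s =
      (n : ℚ) * ∑ K ∈ range (n + 1), cell 6 1 0 n K s - 2 * ∑ K ∈ range (n + 1), (K : ℚ) * cell 6 1 0 n K s := by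
    rw [mul_sum, mul_sum, ← sum_sub_distrib]
    exact sum_congr rfl fun K _ => by ring
  rw [this, h0]; ring

/-! ### The residual as a derivative -/

/-- **`Zudilin2002.integrality` from the first `K`-moments of the centre-free kernel** (the derivatives `p̃′_{s,n}(1)` of the
plain kernel's coefficient polynomials): if for every `n`
`2·Σ_K K·c̃_{K,5}(n) ∈ ℤ₍₂₎`, `2D_n²·Σ_K K·c̃_{K,3}(n) ∈ ℤ₍₂₎` and `D_n⁵·Σ_K (n−2K)·c̃⁰_K(n) ∈ ℤ₍₂₎`
(`c̃⁰_K = cellZero 6 1 0 n K` the harmonic cell), then `4D_n²qₙ, 4D_n⁷pₙ, 4D_n⁵p̃ₙ ∈ ℤ` for all `n ≥ 1`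
(`moment_eq_neg_two_mul` + `integrality_of_moments`). [cite: Zudilin2002Zeta5, Sect. 2 (7), (14)–(15)] -/
theorem integrality_of_derivative
    (h : ∀ n : ℕ,
      Rat.padicValuation 2 (2 * ∑ K ∈ range (n + 1), (K : ℚ) * cell 6 1 0 n K 5) ≤ 1 ∧
        Rat.padicValuation 2 (2 * (((Nat.lcmUpto n : ℕ) : ℚ) ^ 2 *
          ∑ K ∈ range (n + 1), (K : ℚ) * cell 6 1 0 n K 3)) ≤ 1 ∧
        Rat.padicValuation 2 (((Nat.lcmUpto n : ℕ) : ℚ) ^ 5 *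
          ∑ K ∈ range (n + 1), ((n : ℚ) - 2 * K) * cellZero 6 1 0 n K) ≤ 1) :
    integrality := by
  refine integrality_of_moments fun n => ?_
  obtain ⟨h5, h3, h0⟩ := h n
  refine ⟨?_, ?_, h0⟩
  · rw [moment_eq_neg_two_mul n (by decide) (by norm_num), neg_mul, Valuation.map_neg]
    exact h5
  · rw [moment_eq_neg_two_mul n (by decide) (by norm_num), show ((Nat.lcmUpto n : ℕ) : ℚ) ^ 2 *
        (-2 * ∑ K ∈ range (n + 1), (K : ℚ) * cell 6 1 0 n K 3) =
        -(2 * (((Nat.lcmUpto n : ℕ) : ℚ) ^ 2 * ∑ K ∈ range (n + 1), (K : ℚ) * cell 6 1 0 n K 3)) by ring,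
      Valuation.map_neg]
    exact h3

end Summit.KontsevichZagierPeriods.Zeta5Search.Zudilin2002IntegralityDerivative
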